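/-
Copyright: cell pub-balaban-gaps, seat ne8 (estimate NE7c), gen 15. Project licence.
-/
import Summits.QuantumFields.BalabanUV.T4Continuum.Spine.NE7b.CompactFibreCreationFloorSUN
import Summits.QuantumFields.BalabanUV.T4Continuum.Spine.NE7b.CompactFibreWindowSUNRate
import Summits.QuantumFields.BalabanUV.T4Continuum.Spine.NE7b.CompactFibreWindowSUNExplicit
import Summits.QuantumFields.BalabanUV.T4Continuum.Spine.NE7b.CompactFibreWindowSUNExplicitTwoSided
import Summits.QuantumFields.BalabanUV.T4Continuum.Spine.NE7c.LiveFactorWindowRate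

/-!
# Road (δ) on the (n)-carrier's CREATION-STEP PRICE for `SU(N)`, ALL `N`: the price with the window-volume letter at print's rate
# `N² − 1` (soft constant, V29 — i.e. V34) or with V33's explicit `c_N`, and V32's letter-abstract price, read at a live
# Hilbert–Schmidt window AND a live large-field radius — ONE price for the grid: floor `× λ₀²`, letter `+ (N² − 1)·log ν₀⁻¹` per bond
# with rate AND constant untouched, `i₀` FREE; the ledger row eventually true for every `λ₀ > 0` (row NE7c; junction J-18 = J-12 ∕ J-13 §3
# for every `N`)

Cell `pub-balaban-gaps` (G2), seat ne8, estimate **NE7c** (`T4IndicatorShell.ShellWeightBound`; two-run artefact, NOT PRINTED in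
[Bałaban 1983–89], NOT PROVED).  Thirty-fourth proof-only file under `Spine/NE7c/`: seat ne6's census files V32
`Spine/NE7b/CompactFibreCreationFloorSUN` (the (n)-carrier's creation-step price on the product Haar fibre `bonds → SU(N)` with the
window-volume letter ABSTRACT: `creationPrice_SUN_of_volumeLetter`), V29 `CompactFibreWindowSUNRate` (the letter at print's rate, soft
constant: `exists_neg_log_pi_sball_le_sharp`) and V33 `CompactFibreWindowSUNExplicit` (the letter with the explicit `c_N`:
`neg_log_pi_sball_le_explicit`) and V37 `CompactFibreWindowSUNExplicitTwoSided` (the explicit two-sided pin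
`abs_neg_log_pi_sball_sub_le_explicit`) consumed BY NAME at road (δ)'s live letters, plus this seat's file 27 `LiveFactorWindowRate` §0
(`rate_mul_log_inv_mul_le`, `log_inv_le_log_inv_mul`).  ne6's V34 `CompactFibreCreationFloorSUNSharp` (p390552 ✓, 2026-08-25) IS V32's theorem with V29's ∕ V33's
letter substituted; this file makes the SAME two substitutions AT LIVE LETTERS directly from the three parents (V34's olean was not yet
built on the check farm at writing time), so §2 below is V34 read at road (δ)'s letters.  Nothing of Bałaban's is named; no `def`; 0 `sorry`.

THE QUESTION (seat census `HOME/ne/NE7c.md` §22, row 49 = rows 46 ∕ 47 (i) ∕ 48 (i) FOR EVERY `N`).  Files 26 (J-12: `SU(2)`, rate-`2`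
letter), 27 §3 (J-13: `SU(2)`, sharp rate `3∕2`) and 29 (J-15: the `SU(N)` PINS) left the all-`N` creation-step PRICE itself unread at live
letters.  Road (δ) lowers the large-field event «some bond at Hilbert–Schmidt distance `≥ δ′` from the centre» to radius `s·δ′`,
`s ∈ [λ₀, 1]`, and the denominator's window `Π_b SB_η` to `Π_b SB_{νη}`, `ν ∈ [ν₀, 1]` (kept as separate letters; in the trace dictionary
`t ↔ η²∕2` the factor on `t` is `ν²`).  Does the step still sell `e^{−P}` with ONE price for the whole grid of assignments, for every `N`,
with V29's RATE `N² − 1 = dim SU(N)` and V33's CONSTANT `c_N` untouched?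

WHAT IS PROVED ([folklore]; the parents' theorems BY NAME at `(νη, sδ′)` plus real arithmetic):
* §1 `exponent_rate_live_le` — any rate `d ≥ 0`, any constant `c`:
  `i₀ − (λ∕2)(sδ′)² + n·(d·log (νη)⁻¹ + c) ≤ i₀ − λ₀²·((λ∕2)δ′²) + n·(d·log η⁻¹ + c) + n·(d·log ν₀⁻¹)`.
* §2 **`creationPrice_SUN_live_of_volumeLetter`** — V32's letter-abstract price with the event at the LIVE radius `sδ′` (`0 ≤ λ₀ ≤ s`) and
  the window, its `hGwin ∕ hIrel` and its letter `b_vol` read AT THE LIVE WINDOW `νη`: conclusion `exp(i₀ − λ₀²·(λ∕2)δ′² + b_vol)` — the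
  radius half of the reading (floor `× λ₀²`, census row 1's pattern), nothing else moved; **`exists_creationPrice_SUN_sharp_live`** — ALL
  `N`, soft constant: for every `0 < ν₀ ≤ 1` ONE `c′ = c + (N² − 1)·log ν₀⁻¹ ≥ 0` such that for all `0 < η ≤ 2`, `ν ∈ [ν₀, 1]`,
  `0 ≤ λ₀ ≤ s` the price is `exp(i₀ − λ₀²·(λ∕2)δ′² + #bonds·((N² − 1)·log η⁻¹ + c′))·(∫F dκ)·∫ G·w·e^{−I}` — V34's
  `exists_creationPrice_SUN_sharp` at live letters: the RATE assignment-free, the live factor in the constant, the SAME price for every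
  assignment; **`creationPrice_SUN_explicit_live`** (`N ≥ 1`) — V34's `creationPrice_SUN_explicit` at live letters: V33's
  `c_N = ((N² − 1)∕2)·log N + N²·log(16π + 2) + log(2N + 1) − log(4π)` UNTOUCHED plus the separate summand `#bonds·(N² − 1)·log ν₀⁻¹`;
  §2b **`abs_neg_log_pi_sball_sub_le_explicit_live`** (`N ≥ 1`, `0 < η ≤ 1∕10`) — V37's explicit two-sided PIN at the live window: the RATE
  on BOTH sides, V37's closed `C_N` plus `(N² − 1)·log ν₀⁻¹` — file 29's soft live pin made explicit.
* §3 **`creationPrice_factor_le_exp_neg_rate_live`** — the LIVE LEDGER at any rate `d`: with `∫F dκ ≤ 1` the live factor of EVERY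
  assignment is `≤ e^{−P}` as soon as `P + i₀ + n·(d·log η⁻¹ + c) + n·(d·log ν₀⁻¹) ≤ λ₀²·(λ∕2)δ′²` (V32's
  `creationPrice_factor_le_exp_neg_of_volumeLetter` ∕ V34's `creationPrice_SUN_explicit_factor_le_exp_neg` with the letter shifted and the
  floor scaled); `ledger_rate_live_iff_print_shifted` (it IS print's ledger for the shifted target `P + n·d·log ν₀⁻¹` and the scaled modulus
  `λ₀²λ`); `eventually_ledger_row_rate_live` (model: floor `∝ ℓ²`, letter `∝ ℓ` — the row stays eventually true for EVERY `λ₀ > 0`, NO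
  clause on `λ₀`; print's power-counting regime for `SU(N)`, `#bonds ∝ ℓ^{4r₀}`, is file 28's `creation_ledger_print_regime_SUN_live`).
* §4 sanity (`N = 2`: the Hilbert–Schmidt rate `3` is file 27's trace rate `3∕2` on `ν²`; a decided toy of §3).
The companion file 35 `LiveFactorProfileSUN` reads print's PROFILE currency (V35 `CompactFibreProfileVolumeSUN`) for every `N`.

CENSUS (row 49 (i), NEW; `HOME/ne/NE7c.md` §22): for the headline's group `SU(N)`, EVERY `N`, the creation step of the (n)-carrier at road
(δ)'s live letters costs exactly what rows 46 ∕ 47 (i) ∕ 48 (i) recorded for `SU(2)`: floor `c ↦ λ₀²c` (class C1, the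
[Balaban1989LargeFieldII] p. 383 margin), volume letter `b ↦ b + (N² − 1)·log ν₀⁻¹` per bond (= `½d(𝔤)·log (ν₀²)⁻¹` in the trace
dictionary, row 47 (i)), print's RATE and V33's explicit CONSTANT untouched, `i₀` FREE; the ledger row stays eventually true for every
`λ₀ > 0` — NO clause on `λ₀`, one `g⋆(λ₀)`.  Identical under (δ-1) and (δ-global…) (single-level letters).  MILD.  BY-NAME EFFECT ON THE WALL:
none (junction ∕ census file).

NOT HERE (honest): `λ` (print's `γ₀W⁻¹`, `γ₀` = GAPS G-B9-09), `i₀` (`CompactFibreWindowCentredSUN`), `η(g_k)`, `δ′_k = g_kA₁p₁(g_k)` and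
that Bałaban's creation-step carrier IS this one — ne6's (A3) ∕ (A1c) list applies verbatim, NC-NE7b-α UNRULED; node O; NE7c.  VERDICT WORD
UNCHANGED: WORK-bound behind node O; INSTANCE 0∕1.  NE7c ∕ NE7b NOT PRINTED ∕ NOT PROVED; spine 0∕9; one finite T⁴ — NOT ℝ⁴, NOT infinite
volume, NOT the mass gap, NOT Clay.
HONEST DEPENDENCY (cell): continuum YM on T⁴ ⇐ BetaPertH ∧ nine spine estimates (0∕9 proved); BetaPertH ⇐ (D1) ∧ (D4) ∧ CAP+tail.
-/

set_option autoImplicit false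

noncomputable section

open MeasureTheory Real Finset Filter
open scoped Matrix.Norms.Frobenius
open Literature.MathematicalPhysics.QuantumFieldTheory (haarProbability)
open Summit.QuantumFields.BalabanUV.T4Continuum.NE7b.CompactFibreCreationFloorSUN
  (creationPrice_SUN_of_volumeLetter)
open Summit.QuantumFields.BalabanUV.T4Continuum.NE7b.CompactFibreWindowSUNRate (exists_neg_log_pi_sball_le_sharp)
open Summit.QuantumFields.BalabanUV.T4Continuum.NE7b.CompactFibreWindowSUNExplicit (neg_log_pi_sball_le_explicit)
open Summit.QuantumFields.BalabanUV.T4Continuum.NE7b.CompactFibreWindowSUNExplicitTwoSided (abs_neg_log_pi_sball_sub_le_explicit)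
open Literature.MathematicalPhysics.QuantumFieldTheory.UnitaryCayley (haarChartConst 𝔼)
open Summit.QuantumFields.BalabanUV.T4Continuum.Spine.NE7c.LiveFactorWindowRate (rate_mul_log_inv_mul_le log_inv_le_log_inv_mul)

namespace Summit.QuantumFields.BalabanUV.T4Continuum.Spine.NE7c.LiveFactorCreationPriceSUN

/-! ## §1 The live exponent is below the assignment-free one, any rate `d ≥ 0` (file 27 §0 BY NAME) -/

/-- **THE LIVE EXPONENT ≤ THE ASSIGNMENT-FREE EXPONENT, ANY RATE**: for `λ ≥ 0`, `0 ≤ λ₀ ≤ s`, `0 < ν₀ ≤ ν`, `η > 0`, `n, d ≥ 0` and any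
constant `c`, `i₀ − (λ∕2)(sδ′)² + n·(d·log (νη)⁻¹ + c) ≤ i₀ − λ₀²·((λ∕2)δ′²) + n·(d·log η⁻¹ + c) + n·(d·log ν₀⁻¹)` — the floor scaled by
`λ₀²`, the rate-`d` letter shifted by `d·log ν₀⁻¹`, the constant untouched. [folklore] -/
theorem exponent_rate_live_le {i₀ lam δ' s lam0 ν ν₀ η n d c : ℝ} (hlam : 0 ≤ lam) (h0 : 0 ≤ lam0) (hs : lam0 ≤ s)
    (hν₀ : 0 < ν₀) (hν : ν₀ ≤ ν) (hη : 0 < η) (hn : 0 ≤ n) (hd : 0 ≤ d) :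
    i₀ - lam / 2 * (s * δ') ^ 2 + n * (d * Real.log (ν * η)⁻¹ + c) ≤
      i₀ - lam0 ^ 2 * (lam / 2 * δ' ^ 2) + n * (d * Real.log η⁻¹ + c) + n * (d * Real.log ν₀⁻¹) := by
  have hsq : lam0 ^ 2 ≤ s ^ 2 := pow_le_pow_left₀ h0 hs 2
  have hfloor : lam0 ^ 2 * (lam / 2 * δ' ^ 2) ≤ lam / 2 * (s * δ') ^ 2 := by
    have hnn : 0 ≤ lam / 2 * δ' ^ 2 := by positivity
    calc lam0 ^ 2 * (lam / 2 * δ' ^ 2) ≤ s ^ 2 * (lam / 2 * δ' ^ 2) := mul_le_mul_of_nonneg_right hsq hnn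
      _ = lam / 2 * (s * δ') ^ 2 := by ring
  have hr := rate_mul_log_inv_mul_le hd hν₀ hν hη
  have hstep : d * Real.log (ν * η)⁻¹ + c ≤ (d * Real.log η⁻¹ + c) + d * Real.log ν₀⁻¹ := by linarith
  have hlog := mul_le_mul_of_nonneg_left hstep hn
  linarith

/-! ## §2 The creation-step price on `bonds → SU(N)` at live letters, ALL `N`: ONE price for the grid -/

section Price

variable {N : ℕ} {B : Type*} [Fintype B] {Y : Type*} [MeasurableSpace Y] (μ : Measure Y) [SFinite μ]

/-- **V32's LETTER-ABSTRACT PRICE AT LIVE LETTERS** (the radius half of the reading).  V32's `creationPrice_SUN_of_volumeLetter` with the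
large-field event at the LIVE radius `s·δ′` (`0 ≤ λ₀ ≤ s`), the denominator's Hilbert–Schmidt window, its two window hypotheses and its volume
letter `b_vol` read AT THE LIVE WINDOW `Π_b SB_{νη}` (any `ν`, `η`: `b_vol` is whatever bound holds there), all other hypotheses verbatim; then
`∫ F·w·e^{−I} ≤ exp(i₀ − λ₀²·(λ∕2)δ′² + b_vol)·(∫F dκ)·∫ G·w·e^{−I}` — the floor scaled by `λ₀²`, nothing else moved. [folklore] -/
theorem creationPrice_SUN_live_of_volumeLetter {η ν s lam0 bvol : ℝ} (h0 : 0 ≤ lam0) (hs : lam0 ≤ s)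
    (F G : (B → Matrix.specialUnitaryGroup (Fin N) ℂ) → ℝ) (w : Y → ℝ)
    (I : (B → Matrix.specialUnitaryGroup (Fin N) ℂ) × Y → ℝ) (m₀ : Y → ℝ) (U₀ : Y → (B → Matrix.specialUnitaryGroup (Fin N) ℂ))
    {i₀ lam δ' : ℝ} (hF0 : ∀ x, 0 ≤ F x) (hG0 : ∀ x, 0 ≤ G x) (hw0 : ∀ y, 0 ≤ w y) (hlam : 0 ≤ lam) (hδ : 0 ≤ δ')
    (hF : ∀ x y, F x ≠ 0 → w y ≠ 0 →
      ∃ b : B, s * δ' ≤ ‖(((U₀ y b)⁻¹ * x b : Matrix.specialUnitaryGroup (Fin N) ℂ) : Matrix (Fin N) (Fin N) ℂ) - 1‖)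
    (hconv : ∀ x y, F x ≠ 0 → w y ≠ 0 →
      m₀ y + lam / 2 * ∑ b, ‖(((U₀ y b)⁻¹ * x b : Matrix.specialUnitaryGroup (Fin N) ℂ) : Matrix (Fin N) (Fin N) ℂ) - 1‖ ^ 2 ≤ I (x, y))
    (hGwin : ∀ y v, w y ≠ 0 →
      v ∈ (Set.univ.pi fun _ : B => {U : Matrix.specialUnitaryGroup (Fin N) ℂ | ‖(U : Matrix (Fin N) (Fin N) ℂ) - 1‖ ≤ ν * η}) →
      1 ≤ G (U₀ y * v))
    (hIrel : ∀ y v, w y ≠ 0 →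
      v ∈ (Set.univ.pi fun _ : B => {U : Matrix.specialUnitaryGroup (Fin N) ℂ | ‖(U : Matrix (Fin N) (Fin N) ℂ) - 1‖ ≤ ν * η}) →
      I (U₀ y * v, y) ≤ m₀ y + i₀)
    (hWpos : 0 < ((Measure.pi fun _ : B => haarProbability (Matrix.specialUnitaryGroup (Fin N) ℂ))
      (Set.univ.pi fun _ : B =>
        {U : Matrix.specialUnitaryGroup (Fin N) ℂ | ‖(U : Matrix (Fin N) (Fin N) ℂ) - 1‖ ≤ ν * η})).toReal)
    (hvol : -Real.log ((Measure.pi fun _ : B => haarProbability (Matrix.specialUnitaryGroup (Fin N) ℂ))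
      (Set.univ.pi fun _ : B =>
        {U : Matrix.specialUnitaryGroup (Fin N) ℂ | ‖(U : Matrix (Fin N) (Fin N) ℂ) - 1‖ ≤ ν * η})).toReal ≤ bvol)
    (hFi : Integrable F (Measure.pi fun _ : B => haarProbability (Matrix.specialUnitaryGroup (Fin N) ℂ)))
    (hGI : ∀ y, w y ≠ 0 →
      Integrable (fun x => G x * exp (-I (x, y))) (Measure.pi fun _ : B => haarProbability (Matrix.specialUnitaryGroup (Fin N) ℂ)))
    (hA' : Integrable (fun z : (B → Matrix.specialUnitaryGroup (Fin N) ℂ) × Y => F z.1 * w z.2 * exp (-I z))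
      ((Measure.pi fun _ : B => haarProbability (Matrix.specialUnitaryGroup (Fin N) ℂ)).prod μ))
    (hB' : Integrable (fun z : (B → Matrix.specialUnitaryGroup (Fin N) ℂ) × Y => G z.1 * w z.2 * exp (-I z))
      ((Measure.pi fun _ : B => haarProbability (Matrix.specialUnitaryGroup (Fin N) ℂ)).prod μ)) :
    ∫ z, F z.1 * w z.2 * exp (-I z) ∂((Measure.pi fun _ : B => haarProbability (Matrix.specialUnitaryGroup (Fin N) ℂ)).prod μ) ≤
      exp (i₀ - lam0 ^ 2 * (lam / 2 * δ' ^ 2) + bvol) *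
        (∫ x, F x ∂(Measure.pi fun _ : B => haarProbability (Matrix.specialUnitaryGroup (Fin N) ℂ))) *
        ∫ z, G z.1 * w z.2 * exp (-I z) ∂((Measure.pi fun _ : B => haarProbability (Matrix.specialUnitaryGroup (Fin N) ℂ)).prod μ) := by
  have hsδ : 0 ≤ s * δ' := mul_nonneg (h0.trans hs) hδ
  -- V32's price at the live letters `(νη, sδ′)`
  have key := creationPrice_SUN_of_volumeLetter μ F G w I m₀ U₀ hF0 hG0 hw0 hlam hsδ hF hconv hGwin hIrel hWpos hvol hFi hGI hA' hB'
  -- the two nonnegative factors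
  have hFint : 0 ≤ ∫ x, F x ∂(Measure.pi fun _ : B => haarProbability (Matrix.specialUnitaryGroup (Fin N) ℂ)) :=
    integral_nonneg hF0
  have hint : 0 ≤ ∫ z, G z.1 * w z.2 * exp (-I z)
      ∂((Measure.pi fun _ : B => haarProbability (Matrix.specialUnitaryGroup (Fin N) ℂ)).prod μ) :=
    integral_nonneg fun z => mul_nonneg (mul_nonneg (hG0 _) (hw0 _)) (exp_pos _).le
  -- the floor at the live radius dominates `λ₀²` times the dead floor
  have hsq : lam0 ^ 2 ≤ s ^ 2 := pow_le_pow_left₀ h0 hs 2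
  have hfloor : lam0 ^ 2 * (lam / 2 * δ' ^ 2) ≤ lam / 2 * (s * δ') ^ 2 := by
    have hnn : 0 ≤ lam / 2 * δ' ^ 2 := by positivity
    calc lam0 ^ 2 * (lam / 2 * δ' ^ 2) ≤ s ^ 2 * (lam / 2 * δ' ^ 2) := mul_le_mul_of_nonneg_right hsq hnn
      _ = lam / 2 * (s * δ') ^ 2 := by ring
  have hexp : exp (i₀ - lam / 2 * (s * δ') ^ 2 + bvol) ≤ exp (i₀ - lam0 ^ 2 * (lam / 2 * δ' ^ 2) + bvol) :=
    Real.exp_le_exp.2 (by linarith)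
  refine key.trans ?_
  have := mul_le_mul_of_nonneg_right (mul_le_mul_of_nonneg_right hexp hFint) hint
  simpa [mul_assoc] using this

/-- **THE CREATION-STEP PRICE WITH THE LETTER AT PRINT's RATE, ALL `N`, AT LIVE LETTERS — ONE PRICE FOR THE GRID** (V34's
`exists_creationPrice_SUN_sharp` read at road (δ)'s letters; V29's `exists_neg_log_pi_sball_le_sharp` BY NAME at `νη`).  For every
`0 < ν₀ ≤ 1` there is ONE `c′ ≥ 0` (V29's `c` plus `(N² − 1)·log ν₀⁻¹`) such that for all `0 < η ≤ 2`, `ν ∈ [ν₀, 1]`, `0 ≤ λ₀ ≤ s` and all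
data satisfying V32's hypotheses with the event at radius `sδ′` and the window at `νη`:
`∫ F·w·e^{−I} ≤ exp(i₀ − λ₀²·(λ∕2)δ′² + #bonds·((N² − 1)·log η⁻¹ + c′))·(∫F dκ)·∫ G·w·e^{−I}` — the RATE `N² − 1 = dim SU(N)` assignment-free,
the live factor inside the constant, the SAME price for every assignment `(s, ν)`. [folklore] -/
theorem exists_creationPrice_SUN_sharp_live {ν₀ : ℝ} (hν₀ : 0 < ν₀) (hν₀1 : ν₀ ≤ 1) :
    ∃ c' : ℝ, 0 ≤ c' ∧ ∀ η ν s lam0 : ℝ, 0 < η → η ≤ 2 → ν₀ ≤ ν → ν ≤ 1 → 0 ≤ lam0 → lam0 ≤ s →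
      ∀ (F G : (B → Matrix.specialUnitaryGroup (Fin N) ℂ) → ℝ) (w : Y → ℝ)
        (I : (B → Matrix.specialUnitaryGroup (Fin N) ℂ) × Y → ℝ) (m₀ : Y → ℝ)
        (U₀ : Y → (B → Matrix.specialUnitaryGroup (Fin N) ℂ)) (i₀ lam δ' : ℝ),
        (∀ x, 0 ≤ F x) → (∀ x, 0 ≤ G x) → (∀ y, 0 ≤ w y) → 0 ≤ lam → 0 ≤ δ' →
        (∀ x y, F x ≠ 0 → w y ≠ 0 →
          ∃ b : B, s * δ' ≤ ‖(((U₀ y b)⁻¹ * x b : Matrix.specialUnitaryGroup (Fin N) ℂ) : Matrix (Fin N) (Fin N) ℂ) - 1‖) →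
        (∀ x y, F x ≠ 0 → w y ≠ 0 →
          m₀ y + lam / 2 * ∑ b, ‖(((U₀ y b)⁻¹ * x b : Matrix.specialUnitaryGroup (Fin N) ℂ) : Matrix (Fin N) (Fin N) ℂ) - 1‖ ^ 2 ≤
            I (x, y)) →
        (∀ y v, w y ≠ 0 →
          v ∈ (Set.univ.pi fun _ : B => {U : Matrix.specialUnitaryGroup (Fin N) ℂ | ‖(U : Matrix (Fin N) (Fin N) ℂ) - 1‖ ≤ ν * η}) →
          1 ≤ G (U₀ y * v)) →
        (∀ y v, w y ≠ 0 →
          v ∈ (Set.univ.pi fun _ : B => {U : Matrix.specialUnitaryGroup (Fin N) ℂ | ‖(U : Matrix (Fin N) (Fin N) ℂ) - 1‖ ≤ ν * η}) →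
          I (U₀ y * v, y) ≤ m₀ y + i₀) →
        Integrable F (Measure.pi fun _ : B => haarProbability (Matrix.specialUnitaryGroup (Fin N) ℂ)) →
        (∀ y, w y ≠ 0 →
          Integrable (fun x => G x * exp (-I (x, y))) (Measure.pi fun _ : B => haarProbability (Matrix.specialUnitaryGroup (Fin N) ℂ))) →
        Integrable (fun z : (B → Matrix.specialUnitaryGroup (Fin N) ℂ) × Y => F z.1 * w z.2 * exp (-I z))
          ((Measure.pi fun _ : B => haarProbability (Matrix.specialUnitaryGroup (Fin N) ℂ)).prod μ) →
        Integrable (fun z : (B → Matrix.specialUnitaryGroup (Fin N) ℂ) × Y => G z.1 * w z.2 * exp (-I z))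
          ((Measure.pi fun _ : B => haarProbability (Matrix.specialUnitaryGroup (Fin N) ℂ)).prod μ) →
        ∫ z, F z.1 * w z.2 * exp (-I z) ∂((Measure.pi fun _ : B => haarProbability (Matrix.specialUnitaryGroup (Fin N) ℂ)).prod μ) ≤
          exp (i₀ - lam0 ^ 2 * (lam / 2 * δ' ^ 2) +
              (Fintype.card B : ℝ) * (((N ^ 2 - 1 : ℕ) : ℝ) * Real.log η⁻¹ + c')) *
            (∫ x, F x ∂(Measure.pi fun _ : B => haarProbability (Matrix.specialUnitaryGroup (Fin N) ℂ))) *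
            ∫ z, G z.1 * w z.2 * exp (-I z)
              ∂((Measure.pi fun _ : B => haarProbability (Matrix.specialUnitaryGroup (Fin N) ℂ)).prod μ) := by
  obtain ⟨c, hc, h⟩ := exists_neg_log_pi_sball_le_sharp (N := N) (B := B)
  have hlog0 : 0 ≤ Real.log ν₀⁻¹ := by
    rw [Real.log_inv]; linarith [Real.log_nonpos hν₀.le hν₀1]
  refine ⟨c + ((N ^ 2 - 1 : ℕ) : ℝ) * Real.log ν₀⁻¹, by positivity, ?_⟩
  intro η ν s lam0 hη hη2 hν hν1 h0 hs F G w I m₀ U₀ i₀ lam δ' hF0 hG0 hw0 hlam hδ hF hconv hGwin hIrel hFi hGI hA' hB'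
  have hνpos : 0 < ν := hν₀.trans_le hν
  have hνη0 : 0 < ν * η := mul_pos hνpos hη
  have hνη2 : ν * η ≤ 2 := (mul_le_of_le_one_left hη.le hν1).trans hη2
  -- V29's letter at the live window, then the rate-`(N² − 1)` loss moved into the constant
  obtain ⟨hpos, hvol⟩ := h (ν * η) hνη0 hνη2
  have hrate := rate_mul_log_inv_mul_le (r := ((N ^ 2 - 1 : ℕ) : ℝ)) (Nat.cast_nonneg _) hν₀ hν hη
  have hvol' : -Real.log ((Measure.pi fun _ : B => haarProbability (Matrix.specialUnitaryGroup (Fin N) ℂ))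
      (Set.univ.pi fun _ : B =>
        {U : Matrix.specialUnitaryGroup (Fin N) ℂ | ‖(U : Matrix (Fin N) (Fin N) ℂ) - 1‖ ≤ ν * η})).toReal ≤
      (Fintype.card B : ℝ) * (((N ^ 2 - 1 : ℕ) : ℝ) * Real.log η⁻¹ + (c + ((N ^ 2 - 1 : ℕ) : ℝ) * Real.log ν₀⁻¹)) := by
    refine hvol.trans (mul_le_mul_of_nonneg_left ?_ (Nat.cast_nonneg _))
    linarith
  exact creationPrice_SUN_live_of_volumeLetter μ h0 hs F G w I m₀ U₀ hF0 hG0 hw0 hlam hδ hF hconv hGwin hIrel hpos hvol'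
    hFi hGI hA' hB'

/-- **THE SAME WITH V33's EXPLICIT CONSTANT, `N ≥ 1`, AT LIVE LETTERS** (V34's `creationPrice_SUN_explicit` read at road (δ)'s letters;
V33's `neg_log_pi_sball_le_explicit` BY NAME at `νη`): for `0 < η ≤ 2`, `0 < ν₀ ≤ ν ≤ 1`, `0 ≤ λ₀ ≤ s`,
`∫ F·w·e^{−I} ≤ exp(i₀ − λ₀²·(λ∕2)δ′² + #bonds·((N² − 1)·log η⁻¹ + c_N) + #bonds·(N² − 1)·log ν₀⁻¹)·(∫F dκ)·∫ G·w·e^{−I}`,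
`c_N = ((N² − 1)∕2)·log N + N²·log(16π + 2) + log(2N + 1) − log(4π)` UNTOUCHED — the SAME constant for every assignment `(s, ν)`.
[folklore] -/
theorem creationPrice_SUN_explicit_live [NeZero N] {η ν ν₀ s lam0 : ℝ} (hη : 0 < η) (hη2 : η ≤ 2) (hν₀ : 0 < ν₀) (hν : ν₀ ≤ ν)
    (hν1 : ν ≤ 1) (h0 : 0 ≤ lam0) (hs : lam0 ≤ s)
    (F G : (B → Matrix.specialUnitaryGroup (Fin N) ℂ) → ℝ) (w : Y → ℝ)
    (I : (B → Matrix.specialUnitaryGroup (Fin N) ℂ) × Y → ℝ) (m₀ : Y → ℝ) (U₀ : Y → (B → Matrix.specialUnitaryGroup (Fin N) ℂ))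
    {i₀ lam δ' : ℝ} (hF0 : ∀ x, 0 ≤ F x) (hG0 : ∀ x, 0 ≤ G x) (hw0 : ∀ y, 0 ≤ w y) (hlam : 0 ≤ lam) (hδ : 0 ≤ δ')
    (hF : ∀ x y, F x ≠ 0 → w y ≠ 0 →
      ∃ b : B, s * δ' ≤ ‖(((U₀ y b)⁻¹ * x b : Matrix.specialUnitaryGroup (Fin N) ℂ) : Matrix (Fin N) (Fin N) ℂ) - 1‖)
    (hconv : ∀ x y, F x ≠ 0 → w y ≠ 0 →
      m₀ y + lam / 2 * ∑ b, ‖(((U₀ y b)⁻¹ * x b : Matrix.specialUnitaryGroup (Fin N) ℂ) : Matrix (Fin N) (Fin N) ℂ) - 1‖ ^ 2 ≤ I (x, y))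
    (hGwin : ∀ y v, w y ≠ 0 →
      v ∈ (Set.univ.pi fun _ : B => {U : Matrix.specialUnitaryGroup (Fin N) ℂ | ‖(U : Matrix (Fin N) (Fin N) ℂ) - 1‖ ≤ ν * η}) →
      1 ≤ G (U₀ y * v))
    (hIrel : ∀ y v, w y ≠ 0 →
      v ∈ (Set.univ.pi fun _ : B => {U : Matrix.specialUnitaryGroup (Fin N) ℂ | ‖(U : Matrix (Fin N) (Fin N) ℂ) - 1‖ ≤ ν * η}) →
      I (U₀ y * v, y) ≤ m₀ y + i₀)
    (hFi : Integrable F (Measure.pi fun _ : B => haarProbability (Matrix.specialUnitaryGroup (Fin N) ℂ)))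
    (hGI : ∀ y, w y ≠ 0 →
      Integrable (fun x => G x * exp (-I (x, y))) (Measure.pi fun _ : B => haarProbability (Matrix.specialUnitaryGroup (Fin N) ℂ)))
    (hA' : Integrable (fun z : (B → Matrix.specialUnitaryGroup (Fin N) ℂ) × Y => F z.1 * w z.2 * exp (-I z))
      ((Measure.pi fun _ : B => haarProbability (Matrix.specialUnitaryGroup (Fin N) ℂ)).prod μ))
    (hB' : Integrable (fun z : (B → Matrix.specialUnitaryGroup (Fin N) ℂ) × Y => G z.1 * w z.2 * exp (-I z))
      ((Measure.pi fun _ : B => haarProbability (Matrix.specialUnitaryGroup (Fin N) ℂ)).prod μ)) :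
    ∫ z, F z.1 * w z.2 * exp (-I z) ∂((Measure.pi fun _ : B => haarProbability (Matrix.specialUnitaryGroup (Fin N) ℂ)).prod μ) ≤
      exp (i₀ - lam0 ^ 2 * (lam / 2 * δ' ^ 2) +
            (Fintype.card B : ℝ) * (((N : ℝ) ^ 2 - 1) * Real.log η⁻¹ +
              (((N : ℝ) ^ 2 - 1) / 2 * Real.log N + (N : ℝ) ^ 2 * Real.log (16 * π + 2) + Real.log (2 * N + 1) - Real.log (4 * π))) +
            (Fintype.card B : ℝ) * (((N : ℝ) ^ 2 - 1) * Real.log ν₀⁻¹)) *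
        (∫ x, F x ∂(Measure.pi fun _ : B => haarProbability (Matrix.specialUnitaryGroup (Fin N) ℂ))) *
        ∫ z, G z.1 * w z.2 * exp (-I z) ∂((Measure.pi fun _ : B => haarProbability (Matrix.specialUnitaryGroup (Fin N) ℂ)).prod μ) := by
  have hνpos : 0 < ν := hν₀.trans_le hν
  have hνη0 : 0 < ν * η := mul_pos hνpos hη
  have hνη2 : ν * η ≤ 2 := (mul_le_of_le_one_left hη.le hν1).trans hη2
  have hsδ : 0 ≤ s * δ' := mul_nonneg (h0.trans hs) hδ
  -- V33's explicit letter at the live window and V32's price there (= V34's `creationPrice_SUN_explicit` at `(νη, sδ′)`)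
  obtain ⟨hpos, hvol⟩ := neg_log_pi_sball_le_explicit (N := N) (B := B) hνη0 hνη2
  have key := creationPrice_SUN_of_volumeLetter μ F G w I m₀ U₀ hF0 hG0 hw0 hlam hsδ hF hconv hGwin hIrel hpos hvol hFi hGI hA' hB'
  -- the two nonnegative factors
  have hFint : 0 ≤ ∫ x, F x ∂(Measure.pi fun _ : B => haarProbability (Matrix.specialUnitaryGroup (Fin N) ℂ)) :=
    integral_nonneg hF0
  have hint : 0 ≤ ∫ z, G z.1 * w z.2 * exp (-I z)
      ∂((Measure.pi fun _ : B => haarProbability (Matrix.specialUnitaryGroup (Fin N) ℂ)).prod μ) :=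
    integral_nonneg fun z => mul_nonneg (mul_nonneg (hG0 _) (hw0 _)) (exp_pos _).le
  -- the rate is nonnegative for `N ≥ 1`
  have hN1 : (1 : ℝ) ≤ N := by exact_mod_cast Nat.one_le_iff_ne_zero.2 (NeZero.ne N)
  have hd : (0 : ℝ) ≤ (N : ℝ) ^ 2 - 1 := by nlinarith
  -- exponent comparison (§1 with `d = N² − 1`, `c = c_N`)
  have hexp := Real.exp_le_exp.2
    (exponent_rate_live_le (i₀ := i₀) (δ' := δ')
      (c := ((N : ℝ) ^ 2 - 1) / 2 * Real.log N + (N : ℝ) ^ 2 * Real.log (16 * π + 2) + Real.log (2 * N + 1) - Real.log (4 * π))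
      hlam h0 hs hν₀ hν hη (Nat.cast_nonneg (Fintype.card B)) hd)
  refine key.trans ?_
  have := mul_le_mul_of_nonneg_right (mul_le_mul_of_nonneg_right hexp hFint) hint
  simpa [mul_assoc] using this

/-! ### §2b The explicit two-sided PIN at a live window, ALL `N ≥ 1` (V37 BY NAME): the rate survives on BOTH sides -/

omit [MeasurableSpace Y] [SFinite μ] in
/-- **THE EXPLICIT TWO-SIDED PIN AT A LIVE WINDOW, ALL `N ≥ 1`** (ne6's V37 `CompactFibreWindowSUNExplicitTwoSided.abs_neg_log_pi_sball_sub_le_explicit`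
BY NAME at `νη`): for `0 < η ≤ 1∕10`, `0 < ν₀ ≤ ν ≤ 1`,
`|−log κ(Π_b SB_{νη}) − #bonds·(N² − 1)·log η⁻¹| ≤ #bonds·(C_N + (N² − 1)·log ν₀⁻¹)` with V37's closed constant `C_N` (the `max` of V33's lower
and V36's upper constants) — the RATE `N² − 1` assignment-free on BOTH sides, the live factor inside the constant: file 29's soft live pin
`exists_abs_neg_log_pi_sball_sub_le_live` made EXPLICIT (the upper side only GAINS, file 27 §0 `log_inv_le_log_inv_mul`). [folklore] -/
theorem abs_neg_log_pi_sball_sub_le_explicit_live [NeZero N] {η ν ν₀ : ℝ} (hη : 0 < η) (hη10 : η ≤ 1 / 10) (hν₀ : 0 < ν₀)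
    (hν : ν₀ ≤ ν) (hν1 : ν ≤ 1) :
    |-Real.log ((Measure.pi fun _ : B => haarProbability (Matrix.specialUnitaryGroup (Fin N) ℂ))
        (Set.univ.pi fun _ : B =>
          {V : Matrix.specialUnitaryGroup (Fin N) ℂ | ‖(V : Matrix (Fin N) (Fin N) ℂ) - 1‖ ≤ ν * η})).toReal -
        (Fintype.card B : ℝ) * (((N : ℝ) ^ 2 - 1) * Real.log η⁻¹)| ≤
      (Fintype.card B : ℝ) *
        (max (((N : ℝ) ^ 2 - 1) / 2 * Real.log N + (N : ℝ) ^ 2 * Real.log (16 * π + 2) + Real.log (2 * N + 1) - Real.log (4 * π))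
            (Real.log π + Real.log (haarChartConst N : ℝ) + (N : ℝ) * N * Real.log 5 +
              Real.log (volume (Metric.closedBall (0 : 𝔼 N) 1)).toReal) +
          ((N : ℝ) ^ 2 - 1) * Real.log ν₀⁻¹) := by
  have hνpos : 0 < ν := hν₀.trans_le hν
  have hνη0 : 0 < ν * η := mul_pos hνpos hη
  have hνη : ν * η ≤ 1 / 10 := (mul_le_of_le_one_left hη.le hν1).trans hη10
  -- V37's explicit pin at the live window
  have h := abs_neg_log_pi_sball_sub_le_explicit (N := N) (B := B) hνη0 hνη
  -- the rate is nonnegative for `N ≥ 1`; the two one-sided losses of the live factor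
  have hN1 : (1 : ℝ) ≤ N := by exact_mod_cast Nat.one_le_iff_ne_zero.2 (NeZero.ne N)
  have hd : (0 : ℝ) ≤ (N : ℝ) ^ 2 - 1 := by nlinarith
  have hn : (0 : ℝ) ≤ (Fintype.card B : ℝ) := Nat.cast_nonneg _
  have h1 := mul_le_mul_of_nonneg_left (rate_mul_log_inv_mul_le hd hν₀ hν hη) hn
  have h2 := mul_le_mul_of_nonneg_left (mul_le_mul_of_nonneg_left (log_inv_le_log_inv_mul hνpos hν1 hη) hd) hn
  have hlog : 0 ≤ Real.log ν₀⁻¹ := by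
    rw [Real.log_inv]; linarith [Real.log_nonpos hν₀.le (hν.trans hν1)]
  have h3 : 0 ≤ (Fintype.card B : ℝ) * (((N : ℝ) ^ 2 - 1) * Real.log ν₀⁻¹) := by positivity
  rw [abs_le] at h ⊢
  obtain ⟨hl, hu⟩ := h
  constructor <;> linarith

end Price

/-! ## §3 The live ledger at any rate: when does the step STILL sell `e^{−P}`? -/

/-- **THE LIVE LEDGER, ANY RATE `d ≥ 0`, ANY CONSTANT `c`**: with `∫F dκ ≤ 1` the live factor of EVERY assignment (`s ≥ λ₀ ≥ 0`,
`ν ∈ [ν₀, 1]`, `η > 0`, `λ ≥ 0`) is `≤ e^{−P}` as soon as the ASSIGNMENT-FREE ledger inequality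
`P + i₀ + n·(d·log η⁻¹ + c) + n·(d·log ν₀⁻¹) ≤ λ₀²·(λ∕2)δ′²` holds — V32 ∕ V34's `…factor_le_exp_neg…` with the letter shifted by
`d·log ν₀⁻¹` per bond and the floor scaled by `λ₀²` (`d = N² − 1` for §2; `d = 2`, `c = log 16` is file 26's; `d = 3∕2`, `c = log 160` is
file 27's, in the trace dictionary). [folklore] -/
theorem creationPrice_factor_le_exp_neg_rate_live {η ν ν₀ s lam0 i₀ lam δ' A P d c : ℝ} {n : ℕ} (hA1 : A ≤ 1)
    (hlam : 0 ≤ lam) (h0 : 0 ≤ lam0) (hs : lam0 ≤ s) (hν₀ : 0 < ν₀) (hν : ν₀ ≤ ν) (hη : 0 < η) (hd : 0 ≤ d)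
    (hledger : P + i₀ + (n : ℝ) * (d * Real.log η⁻¹ + c) + (n : ℝ) * (d * Real.log ν₀⁻¹) ≤ lam0 ^ 2 * (lam / 2 * δ' ^ 2)) :
    exp (i₀ - lam / 2 * (s * δ') ^ 2 + (n : ℝ) * (d * Real.log (ν * η)⁻¹ + c)) * A ≤ exp (-P) := by
  have hle := exponent_rate_live_le (i₀ := i₀) (δ' := δ') (c := c) hlam h0 hs hν₀ hν hη (Nat.cast_nonneg n) hd
  calc exp (i₀ - lam / 2 * (s * δ') ^ 2 + (n : ℝ) * (d * Real.log (ν * η)⁻¹ + c)) * A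
      ≤ exp (i₀ - lam / 2 * (s * δ') ^ 2 + (n : ℝ) * (d * Real.log (ν * η)⁻¹ + c)) * 1 :=
        mul_le_mul_of_nonneg_left hA1 (exp_pos _).le
    _ ≤ exp (-P) := by rw [mul_one]; exact Real.exp_le_exp.2 (by linarith)

/-- The live ledger IS print's ledger for the SHIFTED target `P + n·d·log ν₀⁻¹` and the SCALED modulus `λ₀²·λ` (pure rewriting).
[folklore] -/
theorem ledger_rate_live_iff_print_shifted {P i₀ n d c η ν₀ lam lam0 δ' : ℝ} :
    P + i₀ + n * (d * Real.log η⁻¹ + c) + n * (d * Real.log ν₀⁻¹) ≤ lam0 ^ 2 * (lam / 2 * δ' ^ 2) ↔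
      (P + n * (d * Real.log ν₀⁻¹)) + i₀ + n * (d * Real.log η⁻¹ + c) ≤ (lam0 ^ 2 * lam) / 2 * δ' ^ 2 := by
  constructor <;> intro h <;> linarith

/-- **THE LIVE LEDGER ROW IS STILL EVENTUALLY TRUE, ANY RATE** (model: the floor grows like `c₁·ℓ²` — `p₁(g)²` at model power — and the
letter like `d·ℓ` with `ℓ = log g⁻²`): for `c₁ > 0`, `λ₀ > 0` and any `P, i₀, n, d, b`: `P + i₀ + n·(d·ℓ + b) ≤ (λ₀²c₁)·ℓ²` for all large
`ℓ` — a POWER against a logarithm, so NO clause on `λ₀` (print's power-counting regime for `SU(N)`, with `n ∝ ℓ^{4r₀}`, is file 28's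
`creation_ledger_print_regime_SUN_live`). [folklore] -/
theorem eventually_ledger_row_rate_live {c₁ P i₀ n d b lam0 : ℝ} (hc : 0 < c₁) (h0 : 0 < lam0) :
    ∀ᶠ ℓ : ℝ in atTop, P + i₀ + n * (d * ℓ + b) ≤ (lam0 ^ 2 * c₁) * ℓ ^ 2 := by
  have ha : 0 < lam0 ^ 2 * c₁ := by positivity
  -- beyond `ℓ₀ := (|n·d| + |P + i₀ + n·b| + 1) ∕ (λ₀²c₁)` (and `ℓ ≥ 1`) the quadratic wins
  refine (eventually_ge_atTop (max 1 ((|n * d| + |P + i₀ + n * b| + 1) / (lam0 ^ 2 * c₁)))).mono fun ℓ hℓ => ?_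
  have hℓ1 : 1 ≤ ℓ := (le_max_left _ _).trans hℓ
  have hℓ2 : (|n * d| + |P + i₀ + n * b| + 1) / (lam0 ^ 2 * c₁) ≤ ℓ := (le_max_right _ _).trans hℓ
  have hℓ2' : |n * d| + |P + i₀ + n * b| + 1 ≤ (lam0 ^ 2 * c₁) * ℓ := by
    rw [div_le_iff₀ ha] at hℓ2; linarith
  have h1 : n * (d * ℓ) ≤ |n * d| * ℓ := by
    rw [← mul_assoc]; exact mul_le_mul_of_nonneg_right (le_abs_self _) (by linarith)
  have h2 : P + i₀ + n * b ≤ |P + i₀ + n * b| * ℓ :=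
    (le_abs_self _).trans (le_mul_of_one_le_right (abs_nonneg _) hℓ1)
  have h3 : (|n * d| + |P + i₀ + n * b| + 1) * ℓ ≤ (lam0 ^ 2 * c₁) * ℓ * ℓ :=
    mul_le_mul_of_nonneg_right hℓ2' (by linarith)
  nlinarith

/-! ## §4 Sanity -/

/-- `N = 2`: the Hilbert–Schmidt-window rate `N² − 1 = 3` — its live loss `3·log ν₀⁻¹` per bond is file 27's trace-window loss
`(3∕2)·log (ν₀²)⁻¹` (the trace deficit is half the squared Hilbert–Schmidt radius, so `ν` on the radius is `ν²` on the deficit). -/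
example (ν₀ : ℝ) : ((2 ^ 2 - 1 : ℕ) : ℝ) * Real.log ν₀⁻¹ = 3 / 2 * Real.log (ν₀ ^ 2)⁻¹ := by
  rw [← inv_pow, Real.log_pow]; push_cast; ring

/-- Decided toy for §3's arithmetic: `P = 1`, `i₀ = 1`, no bonds, `λ₀ = ½`, `λ = 16`, `δ′ = 1`, any rate `d = 3`, `c = 0`: the live floor
`λ₀²·(λ∕2)δ′² = 2 = P + i₀`, so the step sells exactly `e^{−1}` at EVERY assignment — here checked at `s = ½`, `ν = ν₀ = η = 1`. -/
example : exp ((1 : ℝ) - 16 / 2 * ((1 / 2 : ℝ) * 1) ^ 2 + ((0 : ℕ) : ℝ) * (3 * Real.log ((1 : ℝ) * 1)⁻¹ + 0)) * (1 : ℝ) ≤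
    exp (-(1 : ℝ)) :=
  creationPrice_factor_le_exp_neg_rate_live (lam0 := 1 / 2) (ν₀ := 1) le_rfl (by norm_num) (by norm_num) le_rfl one_pos le_rfl one_pos
    (by norm_num) (by push_cast; norm_num)

end Summit.QuantumFields.BalabanUV.T4Continuum.Spine.NE7c.LiveFactorCreationPriceSUN

end
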